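import Summits.Ventures.QEC.CircuitDistance.PortK2Complete
import Summits.Ventures.QEC.CircuitDistance.PortK2DataBB72X
import Summits.Ventures.QEC.CircuitDistance.PortK2DataBB72Z
import Summits.Ventures.QEC.CircuitDistance.PortBB72Value
import Summits.Ventures.QEC.Census.BB.BB72KBRank
import HarnessLib

/-!
# P3-PORT (K2 instance, [[72,12,6]]): the K2 instances of both sectors, their `check`s by `decide`, the `hlog` transport
# from `Census.BB72KB`, and the DISCHARGE of the list-completeness binders `K2_BB72_X`, `K2_BB72_Z` — hence the
# UNCONDITIONAL value `circuitDistance bb72SM Nc = 6` for every `Nc ≥ 1` (cell `qec`, experiment CDX, seat qec-cdx-type-1)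

(A₁,A₂,A₃)=(x³,y,y²) per SI p.10 L83; (B₁,B₂,B₃)=(y³,x,x²) per print's positional convention; authors' software labelling = provenance (acq-14097 pending).
-/

namespace Summit.Ventures.QEC.CircuitDistance

open Literature.InformationTheory.QuantumCodes Finset K2

/-! ## Data -/

/-- The 180 X-sector class supports in checker order. DATA. -/
def gsuppX72 : List (Finset (BB.Mono 6 6 ⊕ BB.Mono 6 6)) :=
  [{Sum.inl (0, 0)}, {Sum.inl (0, 1)}, {Sum.inl (0, 2)}, {Sum.inl (0, 3)},
  {Sum.inl (0, 4)}, {Sum.inl (0, 5)}, {Sum.inl (1, 0)}, {Sum.inl (1, 1)},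
  {Sum.inl (1, 2)}, {Sum.inl (1, 3)}, {Sum.inl (1, 4)}, {Sum.inl (1, 5)},
  {Sum.inl (2, 0)}, {Sum.inl (2, 1)}, {Sum.inl (2, 2)}, {Sum.inl (2, 3)},
  {Sum.inl (2, 4)}, {Sum.inl (2, 5)}, {Sum.inl (3, 0)}, {Sum.inl (3, 1)},
  {Sum.inl (3, 2)}, {Sum.inl (3, 3)}, {Sum.inl (3, 4)}, {Sum.inl (3, 5)},
  {Sum.inl (4, 0)}, {Sum.inl (4, 1)}, {Sum.inl (4, 2)}, {Sum.inl (4, 3)},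
  {Sum.inl (4, 4)}, {Sum.inl (4, 5)}, {Sum.inl (5, 0)}, {Sum.inl (5, 1)},
  {Sum.inl (5, 2)}, {Sum.inl (5, 3)}, {Sum.inl (5, 4)}, {Sum.inl (5, 5)},
  {Sum.inr (0, 0)}, {Sum.inr (0, 1)}, {Sum.inr (0, 2)}, {Sum.inr (0, 3)},
  {Sum.inr (0, 4)}, {Sum.inr (0, 5)}, {Sum.inr (1, 0)}, {Sum.inr (1, 1)},
  {Sum.inr (1, 2)}, {Sum.inr (1, 3)}, {Sum.inr (1, 4)}, {Sum.inr (1, 5)},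
  {Sum.inr (2, 0)}, {Sum.inr (2, 1)}, {Sum.inr (2, 2)}, {Sum.inr (2, 3)},
  {Sum.inr (2, 4)}, {Sum.inr (2, 5)}, {Sum.inr (3, 0)}, {Sum.inr (3, 1)},
  {Sum.inr (3, 2)}, {Sum.inr (3, 3)}, {Sum.inr (3, 4)}, {Sum.inr (3, 5)},
  {Sum.inr (4, 0)}, {Sum.inr (4, 1)}, {Sum.inr (4, 2)}, {Sum.inr (4, 3)},
  {Sum.inr (4, 4)}, {Sum.inr (4, 5)}, {Sum.inr (5, 0)}, {Sum.inr (5, 1)},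
  {Sum.inr (5, 2)}, {Sum.inr (5, 3)}, {Sum.inr (5, 4)}, {Sum.inr (5, 5)},
  {Sum.inl (0, 2), Sum.inl (3, 0)}, {Sum.inl (0, 3), Sum.inl (3, 1)}, {Sum.inl (0, 4), Sum.inl (3, 2)}, {Sum.inl (0, 5), Sum.inl (3, 3)},
  {Sum.inl (0, 0), Sum.inl (3, 4)}, {Sum.inl (0, 1), Sum.inl (3, 5)}, {Sum.inl (1, 2), Sum.inl (4, 0)}, {Sum.inl (1, 3), Sum.inl (4, 1)},
  {Sum.inl (1, 4), Sum.inl (4, 2)}, {Sum.inl (1, 5), Sum.inl (4, 3)}, {Sum.inl (1, 0), Sum.inl (4, 4)}, {Sum.inl (1, 1), Sum.inl (4, 5)},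
  {Sum.inl (2, 2), Sum.inl (5, 0)}, {Sum.inl (2, 3), Sum.inl (5, 1)}, {Sum.inl (2, 4), Sum.inl (5, 2)}, {Sum.inl (2, 5), Sum.inl (5, 3)},
  {Sum.inl (2, 0), Sum.inl (5, 4)}, {Sum.inl (2, 1), Sum.inl (5, 5)}, {Sum.inl (0, 0), Sum.inl (3, 2)}, {Sum.inl (0, 1), Sum.inl (3, 3)},
  {Sum.inl (0, 2), Sum.inl (3, 4)}, {Sum.inl (0, 3), Sum.inl (3, 5)}, {Sum.inl (0, 4), Sum.inl (3, 0)}, {Sum.inl (0, 5), Sum.inl (3, 1)},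
  {Sum.inl (1, 0), Sum.inl (4, 2)}, {Sum.inl (1, 1), Sum.inl (4, 3)}, {Sum.inl (1, 2), Sum.inl (4, 4)}, {Sum.inl (1, 3), Sum.inl (4, 5)},
  {Sum.inl (1, 4), Sum.inl (4, 0)}, {Sum.inl (1, 5), Sum.inl (4, 1)}, {Sum.inl (2, 0), Sum.inl (5, 2)}, {Sum.inl (2, 1), Sum.inl (5, 3)},
  {Sum.inl (2, 2), Sum.inl (5, 4)}, {Sum.inl (2, 3), Sum.inl (5, 5)}, {Sum.inl (2, 4), Sum.inl (5, 0)}, {Sum.inl (2, 5), Sum.inl (5, 1)},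
  {Sum.inl (0, 1), Sum.inr (1, 0)}, {Sum.inl (0, 2), Sum.inr (1, 1)}, {Sum.inl (0, 3), Sum.inr (1, 2)}, {Sum.inl (0, 4), Sum.inr (1, 3)},
  {Sum.inl (0, 5), Sum.inr (1, 4)}, {Sum.inl (0, 0), Sum.inr (1, 5)}, {Sum.inl (1, 1), Sum.inr (2, 0)}, {Sum.inl (1, 2), Sum.inr (2, 1)},
  {Sum.inl (1, 3), Sum.inr (2, 2)}, {Sum.inl (1, 4), Sum.inr (2, 3)}, {Sum.inl (1, 5), Sum.inr (2, 4)}, {Sum.inl (1, 0), Sum.inr (2, 5)},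
  {Sum.inl (2, 1), Sum.inr (3, 0)}, {Sum.inl (2, 2), Sum.inr (3, 1)}, {Sum.inl (2, 3), Sum.inr (3, 2)}, {Sum.inl (2, 4), Sum.inr (3, 3)},
  {Sum.inl (2, 5), Sum.inr (3, 4)}, {Sum.inl (2, 0), Sum.inr (3, 5)}, {Sum.inl (3, 1), Sum.inr (4, 0)}, {Sum.inl (3, 2), Sum.inr (4, 1)},
  {Sum.inl (3, 3), Sum.inr (4, 2)}, {Sum.inl (3, 4), Sum.inr (4, 3)}, {Sum.inl (3, 5), Sum.inr (4, 4)}, {Sum.inl (3, 0), Sum.inr (4, 5)},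
  {Sum.inl (4, 1), Sum.inr (5, 0)}, {Sum.inl (4, 2), Sum.inr (5, 1)}, {Sum.inl (4, 3), Sum.inr (5, 2)}, {Sum.inl (4, 4), Sum.inr (5, 3)},
  {Sum.inl (4, 5), Sum.inr (5, 4)}, {Sum.inl (4, 0), Sum.inr (5, 5)}, {Sum.inl (5, 1), Sum.inr (0, 0)}, {Sum.inl (5, 2), Sum.inr (0, 1)},
  {Sum.inl (5, 3), Sum.inr (0, 2)}, {Sum.inl (5, 4), Sum.inr (0, 3)}, {Sum.inl (5, 5), Sum.inr (0, 4)}, {Sum.inl (5, 0), Sum.inr (0, 5)},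
  {Sum.inl (0, 2), Sum.inl (3, 0), Sum.inr (2, 0)}, {Sum.inl (0, 3), Sum.inl (3, 1), Sum.inr (2, 1)}, {Sum.inl (0, 4), Sum.inl (3, 2), Sum.inr (2, 2)}, {Sum.inl (0, 5), Sum.inl (3, 3), Sum.inr (2, 3)},
  {Sum.inl (0, 0), Sum.inl (3, 4), Sum.inr (2, 4)}, {Sum.inl (0, 1), Sum.inl (3, 5), Sum.inr (2, 5)}, {Sum.inl (1, 2), Sum.inl (4, 0), Sum.inr (3, 0)}, {Sum.inl (1, 3), Sum.inl (4, 1), Sum.inr (3, 1)},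
  {Sum.inl (1, 4), Sum.inl (4, 2), Sum.inr (3, 2)}, {Sum.inl (1, 5), Sum.inl (4, 3), Sum.inr (3, 3)}, {Sum.inl (1, 0), Sum.inl (4, 4), Sum.inr (3, 4)}, {Sum.inl (1, 1), Sum.inl (4, 5), Sum.inr (3, 5)},
  {Sum.inl (2, 2), Sum.inl (5, 0), Sum.inr (4, 0)}, {Sum.inl (2, 3), Sum.inl (5, 1), Sum.inr (4, 1)}, {Sum.inl (2, 4), Sum.inl (5, 2), Sum.inr (4, 2)}, {Sum.inl (2, 5), Sum.inl (5, 3), Sum.inr (4, 3)},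
  {Sum.inl (2, 0), Sum.inl (5, 4), Sum.inr (4, 4)}, {Sum.inl (2, 1), Sum.inl (5, 5), Sum.inr (4, 5)}, {Sum.inl (0, 0), Sum.inl (3, 2), Sum.inr (5, 0)}, {Sum.inl (0, 1), Sum.inl (3, 3), Sum.inr (5, 1)},
  {Sum.inl (0, 2), Sum.inl (3, 4), Sum.inr (5, 2)}, {Sum.inl (0, 3), Sum.inl (3, 5), Sum.inr (5, 3)}, {Sum.inl (0, 4), Sum.inl (3, 0), Sum.inr (5, 4)}, {Sum.inl (0, 5), Sum.inl (3, 1), Sum.inr (5, 5)},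
  {Sum.inl (1, 0), Sum.inl (4, 2), Sum.inr (0, 0)}, {Sum.inl (1, 1), Sum.inl (4, 3), Sum.inr (0, 1)}, {Sum.inl (1, 2), Sum.inl (4, 4), Sum.inr (0, 2)}, {Sum.inl (1, 3), Sum.inl (4, 5), Sum.inr (0, 3)},
  {Sum.inl (1, 4), Sum.inl (4, 0), Sum.inr (0, 4)}, {Sum.inl (1, 5), Sum.inl (4, 1), Sum.inr (0, 5)}, {Sum.inl (2, 0), Sum.inl (5, 2), Sum.inr (1, 0)}, {Sum.inl (2, 1), Sum.inl (5, 3), Sum.inr (1, 1)},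
  {Sum.inl (2, 2), Sum.inl (5, 4), Sum.inr (1, 2)}, {Sum.inl (2, 3), Sum.inl (5, 5), Sum.inr (1, 3)}, {Sum.inl (2, 4), Sum.inl (5, 0), Sum.inr (1, 4)}, {Sum.inl (2, 5), Sum.inl (5, 1), Sum.inr (1, 5)}]

/-- The 12 `Z`-logical supports (`Census.BB72KB.lzVec`, unflattened). DATA. -/
def lsuppX72 : List (Finset (BB.Mono 6 6 ⊕ BB.Mono 6 6)) :=
  [{Sum.inl (0, 0), Sum.inl (0, 1), Sum.inl (0, 4), Sum.inl (0, 5), Sum.inl (3, 0), Sum.inl (3, 2)},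
  {Sum.inl (0, 0), Sum.inl (0, 1), Sum.inl (0, 2), Sum.inl (0, 5), Sum.inl (3, 1), Sum.inl (3, 3)},
  {Sum.inl (0, 2), Sum.inl (0, 3), Sum.inl (0, 4), Sum.inl (0, 5), Sum.inl (3, 0), Sum.inl (3, 4)},
  {Sum.inl (0, 0), Sum.inl (0, 3), Sum.inl (0, 4), Sum.inl (0, 5), Sum.inl (3, 1), Sum.inl (3, 5)},
  {Sum.inl (1, 0), Sum.inl (1, 1), Sum.inl (1, 4), Sum.inl (1, 5), Sum.inl (4, 0), Sum.inl (4, 2)},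
  {Sum.inl (1, 0), Sum.inl (1, 1), Sum.inl (1, 2), Sum.inl (1, 5), Sum.inl (4, 1), Sum.inl (4, 3)},
  {Sum.inl (0, 0), Sum.inl (0, 4), Sum.inl (1, 1), Sum.inl (1, 2), Sum.inl (1, 5), Sum.inl (3, 0), Sum.inl (3, 1), Sum.inl (4, 1), Sum.inr (0, 0), Sum.inr (0, 1), Sum.inr (0, 2), Sum.inr (1, 0), Sum.inr (1, 1), Sum.inr (1, 2)},
  {Sum.inl (1, 3), Sum.inl (1, 4), Sum.inl (4, 0), Sum.inl (4, 1), Sum.inr (0, 0), Sum.inr (0, 3), Sum.inr (1, 0), Sum.inr (1, 3)},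
  {Sum.inl (0, 0), Sum.inl (0, 5), Sum.inl (1, 2), Sum.inl (1, 5), Sum.inl (2, 0), Sum.inl (2, 1), Sum.inl (2, 2), Sum.inl (2, 5), Sum.inl (3, 1), Sum.inl (4, 1), Sum.inl (5, 1), Sum.inr (0, 0), Sum.inr (0, 2), Sum.inr (1, 0), Sum.inr (1, 1), Sum.inr (2, 0)},
  {Sum.inl (0, 0), Sum.inl (0, 5), Sum.inl (1, 2), Sum.inl (1, 3), Sum.inl (1, 4), Sum.inl (2, 2), Sum.inl (2, 3), Sum.inl (2, 4), Sum.inl (2, 5), Sum.inl (3, 1), Sum.inl (4, 0), Sum.inl (4, 1), Sum.inl (5, 0), Sum.inr (0, 0), Sum.inr (0, 2), Sum.inr (0, 3), Sum.inr (1, 0), Sum.inr (2, 1)},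
  {Sum.inl (0, 0), Sum.inl (0, 4), Sum.inl (1, 0), Sum.inl (1, 1), Sum.inl (1, 2), Sum.inl (1, 3), Sum.inl (2, 0), Sum.inl (2, 2), Sum.inl (2, 3), Sum.inl (2, 4), Sum.inl (2, 5), Sum.inl (3, 0), Sum.inl (3, 1), Sum.inl (5, 0), Sum.inr (0, 0), Sum.inr (0, 1), Sum.inr (0, 2), Sum.inr (0, 3), Sum.inr (1, 1), Sum.inr (2, 2)},
  {Sum.inl (0, 0), Sum.inl (0, 5), Sum.inl (1, 2), Sum.inl (1, 3), Sum.inl (1, 4), Sum.inl (1, 5), Sum.inl (2, 0), Sum.inl (2, 1), Sum.inl (2, 2), Sum.inl (2, 3), Sum.inl (2, 4), Sum.inl (2, 5), Sum.inl (3, 1), Sum.inl (4, 0), Sum.inl (5, 0), Sum.inr (0, 2), Sum.inr (0, 3), Sum.inr (1, 0), Sum.inr (1, 1), Sum.inr (2, 3)}]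

/-- Stop witnesses of the X cubes: (word index, translation). DATA. -/
def witX72 : List (List (ℕ × BB.Mono 6 6)) := [[(0, (0, 0))], [], [], [], []]

/-- The 180 Z-sector class supports in checker order. DATA. -/
def gsuppZ72 : List (Finset (BB.Mono 6 6 ⊕ BB.Mono 6 6)) :=
  [{Sum.inl (0, 0)}, {Sum.inl (0, 1)}, {Sum.inl (0, 2)}, {Sum.inl (0, 3)},
  {Sum.inl (0, 4)}, {Sum.inl (0, 5)}, {Sum.inl (1, 0)}, {Sum.inl (1, 1)},
  {Sum.inl (1, 2)}, {Sum.inl (1, 3)}, {Sum.inl (1, 4)}, {Sum.inl (1, 5)},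
  {Sum.inl (2, 0)}, {Sum.inl (2, 1)}, {Sum.inl (2, 2)}, {Sum.inl (2, 3)},
  {Sum.inl (2, 4)}, {Sum.inl (2, 5)}, {Sum.inl (3, 0)}, {Sum.inl (3, 1)},
  {Sum.inl (3, 2)}, {Sum.inl (3, 3)}, {Sum.inl (3, 4)}, {Sum.inl (3, 5)},
  {Sum.inl (4, 0)}, {Sum.inl (4, 1)}, {Sum.inl (4, 2)}, {Sum.inl (4, 3)},
  {Sum.inl (4, 4)}, {Sum.inl (4, 5)}, {Sum.inl (5, 0)}, {Sum.inl (5, 1)},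
  {Sum.inl (5, 2)}, {Sum.inl (5, 3)}, {Sum.inl (5, 4)}, {Sum.inl (5, 5)},
  {Sum.inr (0, 0)}, {Sum.inr (0, 1)}, {Sum.inr (0, 2)}, {Sum.inr (0, 3)},
  {Sum.inr (0, 4)}, {Sum.inr (0, 5)}, {Sum.inr (1, 0)}, {Sum.inr (1, 1)},
  {Sum.inr (1, 2)}, {Sum.inr (1, 3)}, {Sum.inr (1, 4)}, {Sum.inr (1, 5)},
  {Sum.inr (2, 0)}, {Sum.inr (2, 1)}, {Sum.inr (2, 2)}, {Sum.inr (2, 3)},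
  {Sum.inr (2, 4)}, {Sum.inr (2, 5)}, {Sum.inr (3, 0)}, {Sum.inr (3, 1)},
  {Sum.inr (3, 2)}, {Sum.inr (3, 3)}, {Sum.inr (3, 4)}, {Sum.inr (3, 5)},
  {Sum.inr (4, 0)}, {Sum.inr (4, 1)}, {Sum.inr (4, 2)}, {Sum.inr (4, 3)},
  {Sum.inr (4, 4)}, {Sum.inr (4, 5)}, {Sum.inr (5, 0)}, {Sum.inr (5, 1)},
  {Sum.inr (5, 2)}, {Sum.inr (5, 3)}, {Sum.inr (5, 4)}, {Sum.inr (5, 5)},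
  {Sum.inr (0, 4), Sum.inr (3, 0)}, {Sum.inr (0, 5), Sum.inr (3, 1)}, {Sum.inr (0, 0), Sum.inr (3, 2)}, {Sum.inr (0, 1), Sum.inr (3, 3)},
  {Sum.inr (0, 2), Sum.inr (3, 4)}, {Sum.inr (0, 3), Sum.inr (3, 5)}, {Sum.inr (1, 4), Sum.inr (4, 0)}, {Sum.inr (1, 5), Sum.inr (4, 1)},
  {Sum.inr (1, 0), Sum.inr (4, 2)}, {Sum.inr (1, 1), Sum.inr (4, 3)}, {Sum.inr (1, 2), Sum.inr (4, 4)}, {Sum.inr (1, 3), Sum.inr (4, 5)},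
  {Sum.inr (2, 4), Sum.inr (5, 0)}, {Sum.inr (2, 5), Sum.inr (5, 1)}, {Sum.inr (2, 0), Sum.inr (5, 2)}, {Sum.inr (2, 1), Sum.inr (5, 3)},
  {Sum.inr (2, 2), Sum.inr (5, 4)}, {Sum.inr (2, 3), Sum.inr (5, 5)}, {Sum.inr (0, 0), Sum.inr (3, 4)}, {Sum.inr (0, 1), Sum.inr (3, 5)},
  {Sum.inr (0, 2), Sum.inr (3, 0)}, {Sum.inr (0, 3), Sum.inr (3, 1)}, {Sum.inr (0, 4), Sum.inr (3, 2)}, {Sum.inr (0, 5), Sum.inr (3, 3)},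
  {Sum.inr (1, 0), Sum.inr (4, 4)}, {Sum.inr (1, 1), Sum.inr (4, 5)}, {Sum.inr (1, 2), Sum.inr (4, 0)}, {Sum.inr (1, 3), Sum.inr (4, 1)},
  {Sum.inr (1, 4), Sum.inr (4, 2)}, {Sum.inr (1, 5), Sum.inr (4, 3)}, {Sum.inr (2, 0), Sum.inr (5, 4)}, {Sum.inr (2, 1), Sum.inr (5, 5)},
  {Sum.inr (2, 2), Sum.inr (5, 0)}, {Sum.inr (2, 3), Sum.inr (5, 1)}, {Sum.inr (2, 4), Sum.inr (5, 2)}, {Sum.inr (2, 5), Sum.inr (5, 3)},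
  {Sum.inl (4, 0), Sum.inl (5, 0), Sum.inr (0, 5)}, {Sum.inl (4, 1), Sum.inl (5, 1), Sum.inr (0, 0)}, {Sum.inl (4, 2), Sum.inl (5, 2), Sum.inr (0, 1)}, {Sum.inl (4, 3), Sum.inl (5, 3), Sum.inr (0, 2)},
  {Sum.inl (4, 4), Sum.inl (5, 4), Sum.inr (0, 3)}, {Sum.inl (4, 5), Sum.inl (5, 5), Sum.inr (0, 4)}, {Sum.inl (0, 0), Sum.inl (5, 0), Sum.inr (1, 5)}, {Sum.inl (0, 1), Sum.inl (5, 1), Sum.inr (1, 0)},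
  {Sum.inl (0, 2), Sum.inl (5, 2), Sum.inr (1, 1)}, {Sum.inl (0, 3), Sum.inl (5, 3), Sum.inr (1, 2)}, {Sum.inl (0, 4), Sum.inl (5, 4), Sum.inr (1, 3)}, {Sum.inl (0, 5), Sum.inl (5, 5), Sum.inr (1, 4)},
  {Sum.inl (0, 0), Sum.inl (1, 0), Sum.inr (2, 5)}, {Sum.inl (0, 1), Sum.inl (1, 1), Sum.inr (2, 0)}, {Sum.inl (0, 2), Sum.inl (1, 2), Sum.inr (2, 1)}, {Sum.inl (0, 3), Sum.inl (1, 3), Sum.inr (2, 2)},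
  {Sum.inl (0, 4), Sum.inl (1, 4), Sum.inr (2, 3)}, {Sum.inl (0, 5), Sum.inl (1, 5), Sum.inr (2, 4)}, {Sum.inl (1, 0), Sum.inl (2, 0), Sum.inr (3, 5)}, {Sum.inl (1, 1), Sum.inl (2, 1), Sum.inr (3, 0)},
  {Sum.inl (1, 2), Sum.inl (2, 2), Sum.inr (3, 1)}, {Sum.inl (1, 3), Sum.inl (2, 3), Sum.inr (3, 2)}, {Sum.inl (1, 4), Sum.inl (2, 4), Sum.inr (3, 3)}, {Sum.inl (1, 5), Sum.inl (2, 5), Sum.inr (3, 4)},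
  {Sum.inl (2, 0), Sum.inl (3, 0), Sum.inr (4, 5)}, {Sum.inl (2, 1), Sum.inl (3, 1), Sum.inr (4, 0)}, {Sum.inl (2, 2), Sum.inl (3, 2), Sum.inr (4, 1)}, {Sum.inl (2, 3), Sum.inl (3, 3), Sum.inr (4, 2)},
  {Sum.inl (2, 4), Sum.inl (3, 4), Sum.inr (4, 3)}, {Sum.inl (2, 5), Sum.inl (3, 5), Sum.inr (4, 4)}, {Sum.inl (3, 0), Sum.inl (4, 0), Sum.inr (5, 5)}, {Sum.inl (3, 1), Sum.inl (4, 1), Sum.inr (5, 0)},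
  {Sum.inl (3, 2), Sum.inl (4, 2), Sum.inr (5, 1)}, {Sum.inl (3, 3), Sum.inl (4, 3), Sum.inr (5, 2)}, {Sum.inl (3, 4), Sum.inl (4, 4), Sum.inr (5, 3)}, {Sum.inl (3, 5), Sum.inl (4, 5), Sum.inr (5, 4)},
  {Sum.inl (4, 0), Sum.inr (0, 5)}, {Sum.inl (4, 1), Sum.inr (0, 0)}, {Sum.inl (4, 2), Sum.inr (0, 1)}, {Sum.inl (4, 3), Sum.inr (0, 2)},
  {Sum.inl (4, 4), Sum.inr (0, 3)}, {Sum.inl (4, 5), Sum.inr (0, 4)}, {Sum.inl (5, 0), Sum.inr (1, 5)}, {Sum.inl (5, 1), Sum.inr (1, 0)},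
  {Sum.inl (5, 2), Sum.inr (1, 1)}, {Sum.inl (5, 3), Sum.inr (1, 2)}, {Sum.inl (5, 4), Sum.inr (1, 3)}, {Sum.inl (5, 5), Sum.inr (1, 4)},
  {Sum.inl (0, 0), Sum.inr (2, 5)}, {Sum.inl (0, 1), Sum.inr (2, 0)}, {Sum.inl (0, 2), Sum.inr (2, 1)}, {Sum.inl (0, 3), Sum.inr (2, 2)},
  {Sum.inl (0, 4), Sum.inr (2, 3)}, {Sum.inl (0, 5), Sum.inr (2, 4)}, {Sum.inl (1, 0), Sum.inr (3, 5)}, {Sum.inl (1, 1), Sum.inr (3, 0)},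
  {Sum.inl (1, 2), Sum.inr (3, 1)}, {Sum.inl (1, 3), Sum.inr (3, 2)}, {Sum.inl (1, 4), Sum.inr (3, 3)}, {Sum.inl (1, 5), Sum.inr (3, 4)},
  {Sum.inl (2, 0), Sum.inr (4, 5)}, {Sum.inl (2, 1), Sum.inr (4, 0)}, {Sum.inl (2, 2), Sum.inr (4, 1)}, {Sum.inl (2, 3), Sum.inr (4, 2)},
  {Sum.inl (2, 4), Sum.inr (4, 3)}, {Sum.inl (2, 5), Sum.inr (4, 4)}, {Sum.inl (3, 0), Sum.inr (5, 5)}, {Sum.inl (3, 1), Sum.inr (5, 0)},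
  {Sum.inl (3, 2), Sum.inr (5, 1)}, {Sum.inl (3, 3), Sum.inr (5, 2)}, {Sum.inl (3, 4), Sum.inr (5, 3)}, {Sum.inl (3, 5), Sum.inr (5, 4)}]

/-- The 12 `X`-logical supports (`Census.BB72KB.lxVec`, unflattened). DATA. -/
def lsuppZ72 : List (Finset (BB.Mono 6 6 ⊕ BB.Mono 6 6)) :=
  [{Sum.inl (0, 3), Sum.inl (1, 0), Sum.inl (2, 0), Sum.inl (2, 3), Sum.inl (3, 0), Sum.inl (4, 0)},
  {Sum.inl (0, 4), Sum.inl (1, 1), Sum.inl (2, 1), Sum.inl (2, 4), Sum.inl (3, 1), Sum.inl (4, 1)},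
  {Sum.inl (0, 5), Sum.inl (1, 2), Sum.inl (2, 2), Sum.inl (2, 5), Sum.inl (3, 2), Sum.inl (4, 2)},
  {Sum.inl (0, 0), Sum.inl (1, 3), Sum.inl (2, 0), Sum.inl (2, 3), Sum.inl (3, 3), Sum.inl (4, 3)},
  {Sum.inl (0, 3), Sum.inl (1, 0), Sum.inl (1, 3), Sum.inl (2, 3), Sum.inl (3, 3), Sum.inl (5, 0)},
  {Sum.inl (0, 4), Sum.inl (1, 1), Sum.inl (1, 4), Sum.inl (2, 4), Sum.inl (3, 4), Sum.inl (5, 1)},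
  {Sum.inl (0, 0), Sum.inl (0, 1), Sum.inl (0, 3), Sum.inl (0, 4), Sum.inl (1, 0), Sum.inl (1, 1), Sum.inl (1, 3), Sum.inl (1, 4), Sum.inr (0, 0), Sum.inr (0, 1), Sum.inr (0, 3), Sum.inr (0, 4)},
  {Sum.inl (0, 0), Sum.inl (0, 2), Sum.inl (0, 3), Sum.inl (0, 5), Sum.inl (1, 0), Sum.inl (1, 2), Sum.inl (1, 3), Sum.inl (1, 5), Sum.inr (0, 0), Sum.inr (0, 2), Sum.inr (0, 3), Sum.inr (0, 5)},
  {Sum.inl (0, 0), Sum.inl (0, 1), Sum.inl (0, 2), Sum.inl (0, 5), Sum.inl (1, 0), Sum.inl (1, 1), Sum.inl (1, 2), Sum.inl (1, 3), Sum.inl (2, 0), Sum.inl (2, 2), Sum.inr (0, 1), Sum.inr (0, 3), Sum.inr (1, 0), Sum.inr (1, 2)},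
  {Sum.inl (0, 2), Sum.inl (0, 4), Sum.inl (1, 0), Sum.inl (1, 2), Sum.inl (2, 1), Sum.inl (2, 3), Sum.inr (0, 0), Sum.inr (0, 1), Sum.inr (0, 2), Sum.inr (0, 3), Sum.inr (1, 1), Sum.inr (1, 3)},
  {Sum.inl (0, 2), Sum.inl (0, 4), Sum.inl (1, 1), Sum.inl (1, 2), Sum.inl (1, 3), Sum.inl (1, 4), Sum.inl (2, 0), Sum.inl (2, 4), Sum.inr (0, 0), Sum.inr (0, 1), Sum.inr (0, 2), Sum.inr (0, 3), Sum.inr (1, 0), Sum.inr (1, 4)},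
  {Sum.inl (0, 0), Sum.inl (0, 1), Sum.inl (0, 4), Sum.inl (0, 5), Sum.inl (1, 0), Sum.inl (1, 1), Sum.inl (1, 2), Sum.inl (1, 5), Sum.inl (2, 1), Sum.inl (2, 5), Sum.inr (0, 0), Sum.inr (0, 2), Sum.inr (1, 1), Sum.inr (1, 5)}]

/-- Stop witnesses of the Z cubes. DATA. -/
def witZ72 : List (List (ℕ × BB.Mono 6 6)) := [[(0, (0, 0)), (0, (3, 4)), (1, (0, 0)), (2, (0, 0)), (3, (0, 0)), (4, (0, 0))], [(5, (1, 0)), (6, (0, 3)), (6, (1, 0))], [], [], []]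

/-- The X-sector K2 instance. -/
def instX72 : K2Inst 6 6 := ⟨d72X, gsuppX72, lsuppX72, Ts72X, lives72X, witX72⟩

/-- The Z-sector K2 instance. -/
def instZ72 : K2Inst 6 6 := ⟨d72Z, gsuppZ72, lsuppZ72, Ts72Z, lives72Z, witZ72⟩

/-- The listed X words. -/
def wordsX72 : List (List (Finset (BB.Mono 6 6 ⊕ BB.Mono 6 6))) := bb72XLeaves.map (·.word)

/-- The listed Z words. -/
def wordsZ72 : List (List (Finset (BB.Mono 6 6 ⊕ BB.Mono 6 6))) := bb72ZLeaves.map (·.word)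

/-! ## Decided facts -/

set_option maxRecDepth 100000 in
set_option maxHeartbeats 4000000000 in
/-- The X instance is consistent with `H^Z`, the translations and the listed words. -/
theorem checkX72 : instX72.check (fun j q => bb72SM.toCode.HZ j q) wordsX72 = true := by decide

set_option maxRecDepth 100000 in
set_option maxHeartbeats 4000000000 in
/-- The Z instance is consistent with `H^X`, the translations and the listed words. -/
theorem checkZ72 : instZ72.check (fun j q => bb72SM.toCode.HX j q) wordsZ72 = true := by decide

/-- DECIDABLE: every X class (any kind, any base index) is a listed support. -/
def classesXOK : Bool :=
  XKind.all.all fun k => (monoList 6 6).all fun i =>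
    match bb72XTable.cls k with
    | none => true
    | some g => decide (trQ i g ∈ gsuppX72)

/-- DECIDABLE: every Z class is a listed support. -/
def classesZOK : Bool :=
  ZKind.all.all fun k => (monoList 6 6).all fun i =>
    match bb72ZTable.cls k with
    | none => true
    | some g => decide (trQ i g ∈ gsuppZ72)

set_option maxRecDepth 100000 in
set_option maxHeartbeats 4000000000 in
/-- The X classes are listed. -/
theorem classesXOK_true : classesXOK = true := by decide

set_option maxRecDepth 100000 in
set_option maxHeartbeats 4000000000 in
/-- The Z classes are listed. -/
theorem classesZOK_true : classesZOK = true := by decide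

set_option maxRecDepth 100000 in
set_option maxHeartbeats 4000000000 in
/-- The unflattened `Z`-logical supports are the certificate's `lzVec`. -/
theorem lsuppX72_spec : ∀ j : Fin 12, ∀ q : BB.Mono 6 6 ⊕ BB.Mono 6 6,
    indic (lsuppX72.getD j ∅) q = Census.BB72KB.lzVec j (BB.Code.qubitIndex q) := by decide

set_option maxRecDepth 100000 in
set_option maxHeartbeats 4000000000 in
/-- The unflattened `X`-logical supports are the certificate's `lxVec`. -/
theorem lsuppZ72_spec : ∀ j : Fin 12, ∀ q : BB.Mono 6 6 ⊕ BB.Mono 6 6,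
    indic (lsuppZ72.getD j ∅) q = Census.BB72KB.lxVec j (BB.Code.qubitIndex q) := by decide

/-! ## `hlog` transport from the flat certificate of `Census.BB72KB` -/

set_option maxRecDepth 20000 in
/-- Every `X`-sector nontrivial residual meets one of the 12 `Z`-logical supports oddly. -/
theorem hlogX72 (v : BB.Mono 6 6 ⊕ BB.Mono 6 6 → ZMod 2)
    (hz : Matrix.mulVec (fun j q => bb72SM.toCode.HZ j q) v = 0) (hn : v ∉ rowSpace bb72SM.toCode.HX) :
    ∃ s ∈ instX72.lsupp, indic s ⬝ᵥ v ≠ 0 := by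
  have hz1 : bb72SM.toCode.HZ.mulVec v = 0 := hz
  rw [bb72SM_toCode] at hz1 hn
  obtain ⟨u, hu⟩ : ∃ u : Fin (6 * 6 + 6 * 6) → ZMod 2, u ∘ (BB.Code.qubitIndex (ℓ := 6) (m := 6)) = v :=
    ⟨v ∘ (BB.Code.qubitIndex (ℓ := 6) (m := 6)).symm,
      funext fun q => by simp only [Function.comp_apply, Equiv.symm_apply_apply]⟩
  have hz' : Matrix.mulVec BB.bb72.HZFlat u = 0 := by rw [BB.Code.HZFlat_mulVec_eq_zero_iff, hu]; exact hz1
  have hn' : u ∉ rowSpace BB.bb72.HXFlat := fun h => hn (by rw [BB.Code.mem_rowSpace_HXFlat_iff, hu] at h; exact h)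
  obtain ⟨j, hj⟩ := Census.BB72KB.hlogX_bb72 u hz' hn'
  have hjl : (j : ℕ) < lsuppX72.length := by
    have := j.2; simp only [lsuppX72, List.length_cons, List.length_nil]; omega
  refine ⟨lsuppX72.getD j ∅, ?_, ?_⟩
  · show lsuppX72.getD j ∅ ∈ lsuppX72
    rw [List.getD_eq_getElem _ _ hjl]; exact List.getElem_mem _
  · have : Census.BB72KB.lzVec j ⬝ᵥ u = indic (lsuppX72.getD j ∅) ⬝ᵥ v := by
      rw [← hu]
      simp only [dotProduct, Function.comp_apply]
      rw [← Equiv.sum_comp (BB.Code.qubitIndex (ℓ := 6) (m := 6))]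
      apply Finset.sum_congr rfl; intro q _
      rw [lsuppX72_spec j q]
    rw [this] at hj; exact hj

set_option maxRecDepth 20000 in
/-- Every `Z`-sector nontrivial residual meets one of the 12 `X`-logical supports oddly. -/
theorem hlogZ72 (v : BB.Mono 6 6 ⊕ BB.Mono 6 6 → ZMod 2)
    (hz : Matrix.mulVec (fun j q => bb72SM.toCode.HX j q) v = 0) (hn : v ∉ rowSpace bb72SM.toCode.HZ) :
    ∃ s ∈ instZ72.lsupp, indic s ⬝ᵥ v ≠ 0 := by
  have hz1 : bb72SM.toCode.HX.mulVec v = 0 := hz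
  rw [bb72SM_toCode] at hz1 hn
  obtain ⟨u, hu⟩ : ∃ u : Fin (6 * 6 + 6 * 6) → ZMod 2, u ∘ (BB.Code.qubitIndex (ℓ := 6) (m := 6)) = v :=
    ⟨v ∘ (BB.Code.qubitIndex (ℓ := 6) (m := 6)).symm,
      funext fun q => by simp only [Function.comp_apply, Equiv.symm_apply_apply]⟩
  have hz' : Matrix.mulVec BB.bb72.HXFlat u = 0 := by rw [BB.Code.HXFlat_mulVec_eq_zero_iff, hu]; exact hz1
  have hn' : u ∉ rowSpace BB.bb72.HZFlat := fun h => hn (by rw [BB.Code.mem_rowSpace_HZFlat_iff, hu] at h; exact h)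
  obtain ⟨j, hj⟩ := Census.BB72KB.hlogZ_bb72 u hz' hn'
  have hjl : (j : ℕ) < lsuppZ72.length := by
    have := j.2; simp only [lsuppZ72, List.length_cons, List.length_nil]; omega
  refine ⟨lsuppZ72.getD j ∅, ?_, ?_⟩
  · show lsuppZ72.getD j ∅ ∈ lsuppZ72
    rw [List.getD_eq_getElem _ _ hjl]; exact List.getElem_mem _
  · have : Census.BB72KB.lxVec j ⬝ᵥ u = indic (lsuppZ72.getD j ∅) ⬝ᵥ v := by
      rw [← hu]
      simp only [dotProduct, Function.comp_apply]
      rw [← Equiv.sum_comp (BB.Code.qubitIndex (ℓ := 6) (m := 6))]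
      apply Finset.sum_congr rfl; intro q _
      rw [lsuppZ72_spec j q]
    rw [this] at hj; exact hj

/-! ## Discharge of the K2 binders and the unconditional value -/

/-- **`K2_BB72_X` holds**: the X-sector representative leaf list of `[[72,12,6]]` is complete. -/
theorem k2_bb72_X : K2_BB72_X := by
  intro x hcls hnt hcard
  have hall := classesXOK_true
  unfold classesXOK at hall
  simp only [List.all_eq_true] at hall
  have hx : ∀ g ∈ x, g ∈ instX72.gsupp := by
    intro g hg
    obtain ⟨k, hk, i, hi⟩ := hcls g hg
    have h := hall k hk i (mem_monoList i)
    cases hck : bb72XTable.cls k with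
    | none => rw [hck] at hi; exact absurd hi (by simp)
    | some g₀ =>
      rw [hck] at hi h
      simp only [Option.map_some, Option.some.injEq] at hi
      simp only [decide_eq_true_eq] at h
      rw [← hi]; exact h
  obtain ⟨wd, hwd, t, hxt⟩ := K2Inst.k2_complete (I := instX72) (Hs := bb72SM.toCode.HX) checkX72 cubes72X
    (fun v t j => HZ_mulVec_translate bb72SM v t j) (fun v t hv => rowSpace_HX_translate bb72SM v t hv) hlogX72
    x hx hnt.1 hnt.2 hcard
  obtain ⟨e, he, rfl⟩ := List.mem_map.1 hwd
  exact ⟨e, he, t, hxt⟩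

/-- **`K2_BB72_Z` holds**: the Z-sector representative leaf list of `[[72,12,6]]` is complete. -/
theorem k2_bb72_Z : K2_BB72_Z := by
  intro x hcls hnt hcard
  have hall := classesZOK_true
  unfold classesZOK at hall
  simp only [List.all_eq_true] at hall
  have hx : ∀ g ∈ x, g ∈ instZ72.gsupp := by
    intro g hg
    obtain ⟨k, hk, i, hi⟩ := hcls g hg
    have h := hall k hk i (mem_monoList i)
    cases hck : bb72ZTable.cls k with
    | none => rw [hck] at hi; exact absurd hi (by simp)
    | some g₀ =>
      rw [hck] at hi h
      simp only [Option.map_some, Option.some.injEq] at hi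
      simp only [decide_eq_true_eq] at h
      rw [← hi]; exact h
  obtain ⟨wd, hwd, t, hxt⟩ := K2Inst.k2_complete (I := instZ72) (Hs := bb72SM.toCode.HZ) checkZ72 cubes72Z
    (fun v t j => HX_mulVec_translate bb72SM v t j) (fun v t hv => rowSpace_HZ_translate bb72SM v t hv) hlogZ72
    x hx hnt.1 hnt.2 hcard
  obtain ⟨e, he, rfl⟩ := List.mem_map.1 hwd
  exact ⟨e, he, t, hxt⟩

/-- ★ **`d_circ([[72,12,6]]) = 6`, UNCONDITIONAL, KERNEL-CERTIFIED**: for every number of syndrome cycles `Nc ≥ 1`, the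
circuit distance of print's depth-7 syndrome-measurement circuit of the `[[72,12,6]]` bivariate-bicycle code
(`bb72SM`, eng-1's `SyndromeCycle.lean` semantics) is exactly `6`. -/
theorem bb72_circuitDistance_eq_six_holds : ∀ Nc : ℕ, 1 ≤ Nc → circuitDistance bb72SM Nc = 6 :=
  bb72_circuitDistance_eq_six k2_bb72_X k2_bb72_Z

/-- eng-1's claim `BB72_circuitDistance_eq_six_claim` HOLDS. -/
theorem BB72_circuitDistance_eq_six_claim_holds : BB72_circuitDistance_eq_six_claim := bb72_claim k2_bb72_X k2_bb72_Z

/-- `CDX_Q1` is FALSE: there is no logical fault of weight `≤ 5` in the `[[72,12,6]]` circuit. -/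
theorem not_CDX_Q1 : ¬ CDX_Q1 := bb72_not_CDX_Q1 k2_bb72_X k2_bb72_Z

end Summit.Ventures.QEC.CircuitDistance
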